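import Literature.AlgebraicGeometry.AbelianSchemes.AbelianSchemeIsLambdaOfAtBaseChange
import Literature.AlgebraicGeometry.AbelianSchemes.AbelianSchemeOverFibreConjugate
import Literature.AlgebraicGeometry.Motives.AbelianVarietyWeilPairingConjugate
import Literature.AlgebraicGeometry.Motives.AbelianVarietyWeilPairingPullback
import Literature.AlgebraicGeometry.Motives.AbelianVarietyWeilPairingDivisorClass
import Literature.AlgebraicGeometry.AbelianVarieties.AbelianVarietyWeilDivisorBundleDictionary
import HarnessLib

/-!
# Mumford's `λ̄ = Λ(𝒪(Θ))` at a `σ`-twisted geometric point, and the `σ`-reading of the level Weil pairing of a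
# polarisation ([MFK94] Def. 6.2–6.3 at the points `s` and `Spec σ ≫ s`; Milne, *Shimura varieties* §14
# «`σ(A, λ, ηK) = (σA, σλ, σηK)`»; Shimura 1998 §18.6; Lang VII §2 Prop. 3)

Layer `Literature/AlgebraicGeometry/AbelianSchemes`, namespace `Literature.AlgebraicGeometry.AbelianSchemes.AbelianSchemeOver`.
KERNEL ONLY: theorems; no definition, no named fact, no instance, no `sorry`.
Cell `hodgecm-mathlib`, M1PRIME-DAG rung 0, W3 junction «(H1-PR) σ-reading of the pairing» (the `hpair` conjunct of the
text of record `DBCSigmaExportR`, B-plan1 P41): after ★ `AbelianSchemeIsLambdaOfAtBaseChange` (the fibre of a base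
change, B-p02) and ★ `AbelianSchemeOverFibreConjugate` (`conjFibreIso : (A_s)^σ ≅ A_{Spec σ ≫ s}`, B-p06), this file
moves [MumfordFogartyKirwan1994, Def. 6.2] «`Λ(L)(x) = T_x^*L ⊗ L⁻¹`» (the tree's `IsLambdaOfAt`) from a field-valued
point `s : Spec L → S` to the TWISTED point `Spec σ ≫ s` of the SAME abelian scheme `A/S` with dual pair `D = (Â, 𝒫)`
and `S`-morphism `λ : A → Â`, for a ring automorphism `σ` of `L`.

THE PRINT.  [Milne2005ShimuraVarieties, §14 pp. 124–125]: for `σ ∈ Aut(ℂ)` the conjugate of a triple is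
«`σ(A, s, ηK) = (σA, σs, σηK)`» — the polarisation `s` of `A` is carried to the polarisation `σs` of `σA`; in the
moduli problem over a base ([MumfordFogartyKirwan1994, Ch. 7 §2 Def. 7.2 (p. 129)], `λ : X → X̂` an `S`-homomorphism
which is `Λ(L̄)` at every geometric point, Def. 6.3 p. 120) this is the statement that the fibre of `(X, λ)` at the
twisted point `Spec σ ≫ s` is the conjugate `((X_s)^σ, (λ̄_s)^σ)` of the fibre at `s`, with `Λ(𝒪(Θ))^σ = Λ(𝒪(Θ^σ))`.
[Shimura1998, §18.6 proof (pp. 129–131)] and [Lang1983AbelianVarieties, Ch. VII §2 Prop. 3] supply the pairing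
side: `e_N^{X^σ}(t^σ, s^σ) = e_N^X(t, s)^σ`, and `ē^Θ_N` depends only on the class of `Θ` (hence only on `λ̄`).

THE MAP.  `ψ := e⁻¹ ≫ π_σ : A_{Spec σ ≫ s} → (A_s)^σ → A_s` on underlying schemes (`e = conjFibreIso`, `π_σ` the
projection of the conjugate, ★ `baseChangeHomFst`) — an isomorphism of abstract schemes, `σ`-SEMILINEAR over `L`,
commuting with the projections to the total space `A` (`toSchemeHom_conjFibreIso_inv_comp_baseChangeHomFst_comp_fst`)
and twisting the projections to `Spec L` by `Spec σ` (`…_comp_snd`).  Passed as a variable `ψ` with its defining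
equation `hψ` (the pattern of ★ `weilPairingLevel_conjugate`'s `π`/`hπ`), so that instance search for `IsDominant ψ`
is the caller's `haveI` (`isDominant_toSchemeHom_conjFibreIso_inv_comp_baseChangeHomFst`).

WHAT IS PROVED (all by composing ★ lemmas; the only «new» content is the slice square at the twisted point):
* §1 `IsLambdaOfAt.weilPairingLevel_eq` — **WITNESS-INDEPENDENCE of `ē^Θ_N`**: two Cartier divisors `Θ, Θ′` on `A_s`
  with `λ̄ = Λ(𝒪(Θ)) = Λ(𝒪(Θ′))` at `s` give the same level Weil pairing on `A_s[N]` (both slices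
  `t_Q^*𝒪(Θ) ⊗ 𝒪(Θ)⁻¹ ≅ 𝒫|_{A_s × {λ̄(Q)}} ≅ t_Q^*𝒪(Θ′) ⊗ 𝒪(Θ′)⁻¹`, then ★
  `weilPairingLevel_eq_of_nonempty_translateTensorDual_iso`, Lang VII §2 Prop. 3) — the «independence of `e^L_N` from
  the witness `Θ`» owed since the D2 carrier (pen ruling P7 of ★ `AbelianSchemePolarization`);
* §2 the geometry of `ψ`: projection formulas, **the slice square** `slice_{λ̄(e(P^σ))} = ψ ≫ slice_{λ̄(P)}`
  (`sliceAt_specTwist_eq_comp_sliceAt`), **the translation square** `t_{e(P^σ)} ≫ ψ = ψ ≫ t_P`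
  (`translation_left_comp_of_specTwist`), and «every `L`-point of `A_{Spec σ ≫ s}` is an `e(P^σ)`»;
* §3 **`IsLambdaOfAt.along_specTwist`**: `λ̄ = Λ(𝒪(Θ))` at `s` ⟹ `λ̄ = Λ(𝒪(ψ^*Θ))` at `Spec σ ≫ s` — B-p02's det-class
  chain verbatim with `ψ` for the fibre identification: `[𝒫|slice′] = ψ^*[𝒫|slice] = ψ^*(t_P^*[Θ]·[Θ]⁻¹) =
  t_{P′}^*[ψ^*Θ]·[ψ^*Θ]⁻¹` in `Ȟ¹(A_{Spec σ ≫ s}, 𝒪^×)`, hence isomorphic rank-one modules (★ `nonempty_iso_iff_detClass_eq`);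
* §4 **`IsLambdaOfAt.weilPairingLevel_specTwist_eq_conjugate`** — THE σ-READING OF THE PAIRING: for ANY witness `Θ′`
  of `λ̄` at `Spec σ ≫ s` and any witness `Θ` at `s`, `ē^{Θ′}_N(P′, Q′) = σ (ē^{Θ}_N(P, Q))` whenever
  `e(P^σ) = P′`, `e(Q^σ) = Q′` (§1 + §3 + ★ `weilPairingLevel_pullback_eq` + ★ `weilPairingLevel_conjugate`).

USE (cell): with B-p13's ★ re-base `Pσ := P′.baseChange (Spec σ)` (`PolarizedAbelianSchemeWithLevelBaseChange` §6) and
B-p02's ★ `IsLambdaOfAt.baseChange`, §4 at `s = 𝟙 (Spec ℂ)` is the `hpair` conjunct of `DBCSigmaExportR` for the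
witness `Θσ` chosen there by `exists_ample` (§1 makes the choice immaterial).  HC_CM is proved only modulo the 7 printed
citations until rung 0 closes; this file discharges none of them.

## References
* [MumfordFogartyKirwan1994] D. Mumford, J. Fogarty, F. Kirwan, *Geometric Invariant Theory*, 3rd ed. (1994), Ch. 6 §2
  Def. 6.2–6.3 (p. 120), Ch. 7 §2 Def. 7.2 (p. 129).
* [Milne2005ShimuraVarieties] J. S. Milne, *Introduction to Shimura varieties* (2005/2017), §11 p. 108 («`σA`»), §14
  pp. 124–125 («`σ(A, s, ηK) = (σA, σs, σηK)`»).
* [Shimura1998] G. Shimura, *Abelian Varieties with Complex Multiplication and Modular Functions* (1998), §18.6 proof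
  (pp. 129–131).
* [Lang1983AbelianVarieties] S. Lang, *Abelian Varieties*, Ch. VII §2 Prop. 3.
* [GortzWedhorn2020] U. Görtz, T. Wedhorn, *Algebraic Geometry I*, 2nd ed. (2020), Section (4.7) and Prop. 4.16,
  Prop. 11.21 (p. 374), Def. 11.49 (p. 392).
* [Hartshorne1977] R. Hartshorne, *Algebraic Geometry* (1977), II Ex. 6.8, III Ex. 4.5.
-/

universe u

open CategoryTheory CategoryTheory.Limits AlgebraicGeometry MonoidalCategory

noncomputable section

namespace Literature.AlgebraicGeometry.Modules

open Literature.AlgebraicGeometry.Motives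

variable {X Y Z : Scheme.{u}}

/-- `f^*(g^*γ) = (f ≫ g)^*γ` on `Ȟ¹(·, 𝒪^×)` (★ `CechPic.pullback_comp` read right to left; re-derived privately from
`detClass_pullback` and `(f ≫ g)^*E ≅ f^*g^*E`, as in ★ `AbelianSchemeIsLambdaOfAtBaseChange`, to stay inside this
file's import cone). [cite: Hartshorne1977, II Ex. 6.8 (a)] -/
private theorem cechPic_pullback_pullback' (f : X ⟶ Y) (g : Y ⟶ Z) (γ : CechPic Z) :
    CechPic.pullback f (CechPic.pullback g γ) = CechPic.pullback (f ≫ g) γ := by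
  obtain ⟨c, rfl⟩ := CechPic.mk_surjective γ
  have hE := c.isFiniteLocallyFree_lineBundle
  rw [← c.detClass_lineBundle, ← detClass_pullback, ← detClass_pullback, ← detClass_pullback]
  exact (detClass_eq_of_iso ((Scheme.Modules.pullbackComp f g).app (lineBundle c)).symm _ _).symm

end Literature.AlgebraicGeometry.Modules

namespace Literature.AlgebraicGeometry.AbelianSchemes

open Literature.AlgebraicGeometry.Motives Literature.AlgebraicGeometry.AbelianVarieties
  Literature.AlgebraicGeometry.Modules
open scoped MonObj CategoryTheory.Obj

namespace AbelianSchemeOver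

set_option backward.isDefEq.respectTransparency false

variable {S : Scheme.{u}} (A : AbelianSchemeOver S) (D : A.DualPair) (lam : A.X ⟶ D.hat.X)
  {L : Type u} [Field L] (σ : L ≃+* L) (s : Spec (.of L) ⟶ S)

/-! ### §1 Witness-independence: `ē^Θ_N` depends only on `λ̄` ([Lang] VII §2 Prop. 3; pen ruling P7) -/

/-- **The level Weil pairing of a polarisation does not depend on the divisor witnessing `λ̄ = Λ(𝒪(Θ))`.**  If
`λ̄ = Λ(𝒪(Θ))` and `λ̄ = Λ(𝒪(Θ′))` at the same point `s` ([MumfordFogartyKirwan1994, Def. 6.2–6.3]: two choices of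
the ample `L̄` with `Λ(L̄) = λ̄`), then `ē^{Θ}_N = ē^{Θ′}_N` on `A_s[N](L)`: both `Λ(𝒪(·))(Q)`-slices are isomorphic to
`𝒫|_{A_s × {λ̄(Q)}}`, hence to each other, and `ē_N(·, Q)` depends only on the class of `t_Q^*Θ − Θ`
(★ `weilPairingLevel_eq_of_nonempty_translateTensorDual_iso`). [cite: Lang1983AbelianVarieties, Ch. VII §2 Prop. 3]
[cite: MumfordFogartyKirwan1994, Ch. 6 §2 Definition 6.2–6.3 (p. 120)] -/
theorem IsLambdaOfAt.weilPairingLevel_eq {Θ Θ' : CartierDivisor (A.fibre s).toAbelianVariety.X.left}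
    (h : A.IsLambdaOfAt s D lam Θ) (h' : A.IsLambdaOfAt s D lam Θ') {N : ℕ}
    [IsDominant (AbelianVariety.Hom.toSchemeHom ((N : ℤ) • 𝟙 (A.fibre s).toAbelianVariety))]
    (P Q : (A.fibre s).toAbelianVariety.torsionPoints L N) :
    (A.fibre s).toAbelianVariety.weilPairingLevel Θ P Q = (A.fibre s).toAbelianVariety.weilPairingLevel Θ' P Q :=
  weilPairingLevel_eq_of_nonempty_translateTensorDual_iso (A.fibre s).toAbelianVariety
    ⟨(h Q.1).some.symm ≪≫ (h' Q.1).some⟩ P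

/-! ### §2 The map `ψ = e⁻¹ ≫ π_σ : A_{Spec σ ≫ s} → A_s` (`e = conjFibreIso`): projections, slices, translations -/

/-- `ψ = e⁻¹ ≫ π_σ` is dominant (an isomorphism followed by the surjective projection of the conjugate).
[cite: GortzWedhorn2020, Section (4.7), Prop. 4.16] -/
theorem isDominant_toSchemeHom_conjFibreIso_inv_comp_baseChangeHomFst :
    IsDominant (AbelianVariety.Hom.toSchemeHom (A.conjFibreIso σ s).inv ≫
      baseChangeHomFst σ.toRingHom (A.fibre s).toAbelianVariety.X) := by
  haveI : IsDominant (AbelianVariety.Hom.toSchemeHom (A.conjFibreIso σ s).inv) :=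
    AbelianVariety.isDominant_toSchemeHom_iso_hom (A.conjFibreIso σ s).symm
  haveI : IsDominant (baseChangeHomFst σ.toRingHom (A.fibre s).toAbelianVariety.X) :=
    AbelianVariety.isDominant_baseChangeHomFst σ (A.fibre s).toAbelianVariety
  infer_instance

/-- `e ≫ pr_A = π_σ ≫ pr_A`: the fibre identification `e : (A_s)^σ ≅ A_{Spec σ ≫ s}` commutes with the projections
to the total space (★ `pullbackFacObjIso_hom_left_fst`). [cite: GortzWedhorn2020, Section (4.7), Prop. 4.16] -/
theorem toSchemeHom_conjFibreIso_hom_comp_fst :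
    AbelianVariety.Hom.toSchemeHom (A.conjFibreIso σ s).hom ≫ pullback.fst A.X.hom (specTwist σ ≫ s) =
      baseChangeHomFst σ.toRingHom (A.fibre s).toAbelianVariety.X ≫ pullback.fst A.X.hom s := by
  change (A.conjFibreIso σ s).hom.hom.hom.hom.left ≫ _ = _
  rw [conjFibreIso_hom_hom_hom_hom]
  erw [Limits.pullbackFacObjIso_hom_left_fst s (specTwist σ) (specTwist σ ≫ s) rfl A.X]
  rfl

/-- `e⁻¹ ≫ e = 𝟙` on underlying schemes (`e = conjFibreIso`, the transitivity-of-base-change isomorphism). [cite: GortzWedhorn2020, Section (4.7), Prop. 4.16] -/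
theorem toSchemeHom_conjFibreIso_inv_comp_hom :
    AbelianVariety.Hom.toSchemeHom (A.conjFibreIso σ s).inv ≫
      AbelianVariety.Hom.toSchemeHom (A.conjFibreIso σ s).hom = 𝟙 _ := by
  change ((A.conjFibreIso σ s).inv ≫ (A.conjFibreIso σ s).hom).hom.hom.hom.left = _
  rw [Iso.inv_hom_id]
  rfl

/-- `e ≫ e⁻¹ = 𝟙` on underlying schemes (`e = conjFibreIso`). [cite: GortzWedhorn2020, Section (4.7), Prop. 4.16] -/
theorem toSchemeHom_conjFibreIso_hom_comp_inv :
    AbelianVariety.Hom.toSchemeHom (A.conjFibreIso σ s).hom ≫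
      AbelianVariety.Hom.toSchemeHom (A.conjFibreIso σ s).inv = 𝟙 _ := by
  change ((A.conjFibreIso σ s).hom ≫ (A.conjFibreIso σ s).inv).hom.hom.hom.left = _
  rw [Iso.hom_inv_id]
  rfl

/-- `e⁻¹(e(x)) = x` on `L`-points of `(A_s)^σ` (`e = conjFibreIso`; points of an iterated base change, Görtz–Wedhorn (4.7.1)). [cite: GortzWedhorn2020, Section (4.7), Prop. 4.16] -/
theorem map_conjFibreIso_inv_map_hom (x : ((A.fibre s).toAbelianVariety.conjugate σ).Points L) :
    AlgPoints.map (A.conjFibreIso σ s).inv.hom.hom.hom (AlgPoints.map (A.conjFibreIso σ s).hom.hom.hom.hom x) = x := by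
  have h : (A.conjFibreIso σ s).hom.hom.hom.hom ≫ (A.conjFibreIso σ s).inv.hom.hom.hom = 𝟙 _ := by
    change ((A.conjFibreIso σ s).hom ≫ (A.conjFibreIso σ s).inv).hom.hom.hom = _
    rw [Iso.hom_inv_id]
    rfl
  rw [← AlgPoints.map_comp_apply, h, AlgPoints.map_id_apply]

/-- `e(e⁻¹(P′)) = P′` on `L`-points of `A_{Spec σ ≫ s}` (`e = conjFibreIso`). [cite: GortzWedhorn2020, Section (4.7), Prop. 4.16] -/
theorem map_conjFibreIso_hom_map_inv (P' : (A.fibre (specTwist σ ≫ s)).toAbelianVariety.Points L) :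
    AlgPoints.map (A.conjFibreIso σ s).hom.hom.hom.hom (AlgPoints.map (A.conjFibreIso σ s).inv.hom.hom.hom P') = P' := by
  have h : (A.conjFibreIso σ s).inv.hom.hom.hom ≫ (A.conjFibreIso σ s).hom.hom.hom.hom = 𝟙 _ := by
    change ((A.conjFibreIso σ s).inv ≫ (A.conjFibreIso σ s).hom).hom.hom.hom = _
    rw [Iso.inv_hom_id]
    rfl
  rw [← AlgPoints.map_comp_apply, h, AlgPoints.map_id_apply]

/-- **Every `L`-point of `A_{Spec σ ≫ s}` is an `e(P^σ)`** (`e` is an isomorphism and `x ↦ x^σ` a bijection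
`A_s(L) ≃ (A_s)^σ(L)`, ★ `conjPoints`). [cite: Milne2005ShimuraVarieties, §11 p. 108 («σP ∈ σA(Ω)»)] -/
theorem exists_eq_map_conjFibreIso_conjPoints (P' : (A.fibre (specTwist σ ≫ s)).toAbelianVariety.Points L) :
    ∃ P : (A.fibre s).toAbelianVariety.Points L,
      AlgPoints.map (A.conjFibreIso σ s).hom.hom.hom.hom ((A.fibre s).toAbelianVariety.conjPoints σ P) = P' :=
  ⟨((A.fibre s).toAbelianVariety.conjPoints σ).symm (AlgPoints.map (A.conjFibreIso σ s).inv.hom.hom.hom P'), by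
    rw [MulEquiv.apply_symm_apply, map_conjFibreIso_hom_map_inv]⟩

section Psi

variable (ψ : (A.fibre (specTwist σ ≫ s)).toAbelianVariety.X.left ⟶ (A.fibre s).toAbelianVariety.X.left)
  (hψ : ψ = AbelianVariety.Hom.toSchemeHom (A.conjFibreIso σ s).inv ≫
    baseChangeHomFst σ.toRingHom (A.fibre s).toAbelianVariety.X)


include hψ in
/-- **`ψ ≫ pr_A = pr_A`**: `ψ : A_{Spec σ ≫ s} → A_s` commutes with the projections to `A`. [cite: GortzWedhorn2020, Section (4.7), Prop. 4.16] -/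
theorem psi_comp_fst : ψ ≫ pullback.fst A.X.hom s = pullback.fst A.X.hom (specTwist σ ≫ s) := by
  rw [hψ, Category.assoc, ← toSchemeHom_conjFibreIso_hom_comp_fst, ← Category.assoc,
    toSchemeHom_conjFibreIso_inv_comp_hom, Category.id_comp]

include hψ in
/-- **`ψ ≫ pr_{Spec L} = pr_{Spec L} ≫ Spec σ`**: `ψ` twists the structure maps by `Spec σ` (it is `σ`-semilinear).
[cite: GortzWedhorn2020, Section (4.7), Prop. 4.16] [cite: Milne2005ShimuraVarieties, §11 p. 108] -/
theorem psi_comp_snd : ψ ≫ pullback.snd A.X.hom s = pullback.snd A.X.hom (specTwist σ ≫ s) ≫ specTwist σ := by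
  have h1 : baseChangeHomFst σ.toRingHom (A.fibre s).toAbelianVariety.X ≫ pullback.snd A.X.hom s =
      ((A.fibre s).toAbelianVariety.conjugate σ).X.hom ≫ specTwist σ :=
    pullback.condition
  have h2 : AbelianVariety.Hom.toSchemeHom (A.conjFibreIso σ s).inv ≫
      ((A.fibre s).toAbelianVariety.conjugate σ).X.hom = pullback.snd A.X.hom (specTwist σ ≫ s) :=
    Over.w (A.conjFibreIso σ s).inv.hom.hom.hom
  rw [hψ, Category.assoc]
  erw [h1]
  rw [← Category.assoc, h2]

include hψ in
/-- **The slice square at the twisted point**: for an `L`-point `P` of `A_s` and `P′ = e(P^σ)` the corresponding point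
of `A_{Spec σ ≫ s}`, the slice `A_{Spec σ ≫ s} → A ×_S Â` at `λ̄(P′)` is `ψ` followed by the slice of `A_s` at `λ̄(P)`
(first components by `psi_comp_fst`; second components: `λ̄(P′) = Spec σ ≫ λ̄(P)` because `P′` lies over
`Spec σ ≫ P ≫ pr_A`, ★ `map_conjFibreIso_conjPoints_left_fst`). [cite: MumfordFogartyKirwan1994, Ch. 6 §2 Definition 6.2 (p. 120)]
[cite: Milne2005ShimuraVarieties, §14 pp. 124–125] -/
theorem sliceAt_specTwist_eq_comp_sliceAt (P : (A.fibre s).toAbelianVariety.Points L) :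
    A.sliceAt (specTwist σ ≫ s) D lam
        (AlgPoints.map (A.conjFibreIso σ s).hom.hom.hom.hom ((A.fibre s).toAbelianVariety.conjPoints σ P)) =
      ψ ≫ A.sliceAt s D lam P := by
  apply pullback.hom_ext
  · rw [sliceAt_fst, Category.assoc, sliceAt_fst, A.psi_comp_fst σ s ψ hψ]
  · rw [sliceAt_snd, Category.assoc, sliceAt_snd, ← Category.assoc ψ, A.psi_comp_snd σ s ψ hψ, Category.assoc]
    congr 1
    simp only [AbelianSchemeOver.valueAt, AbelianSchemeOver.fibrePointToLeft]
    erw [A.map_conjFibreIso_conjPoints_left_fst σ s P]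
    simp only [Category.assoc]

include hψ in
/-- **The translation square**: `t_{e(P^σ)} ≫ ψ = ψ ≫ t_P` (the isomorphism `e⁻¹` intertwines translations,
★ `translation_left_comp_toSchemeHom`; `t_{P^σ} ≫ π_σ = π_σ ≫ t_P`, ★ `translation_conjPoints_left_comp_fst`).
[cite: Shimura1998, §18.6 proof (p. 130)] [cite: MumfordAV1970, §4 (Cor. 1 of the rigidity lemma)] -/
theorem translation_left_comp_psi (P : (A.fibre s).toAbelianVariety.Points L) :
    ((A.fibre (specTwist σ ≫ s)).toAbelianVariety.translation
        (AlgPoints.map (A.conjFibreIso σ s).hom.hom.hom.hom ((A.fibre s).toAbelianVariety.conjPoints σ P))).left ≫ ψ =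
      ψ ≫ ((A.fibre s).toAbelianVariety.translation P).left := by
  rw [hψ, ← Category.assoc,
    AbelianVariety.translation_left_comp_toSchemeHom (A.conjFibreIso σ s).inv, map_conjFibreIso_inv_map_hom,
    Category.assoc, AbelianVariety.translation_conjPoints_left_comp_fst σ (A.fibre s).toAbelianVariety P,
    Category.assoc]

/-! ### §3 `λ̄ = Λ(𝒪(Θ))` at `s` ⟹ `λ̄ = Λ(𝒪(ψ^*Θ))` at `Spec σ ≫ s` (det-class chain) -/

include hψ in
/-- **The class of the slice of `𝒫` at `λ̄(e(P^σ))` is `ψ^*` of the class of the slice at `λ̄(P)`** (slice square +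
`(ψ ≫ slice)^* ≅ ψ^* slice^*`; any finite-local-freeness witnesses). [cite: MumfordFogartyKirwan1994, Ch. 6 §2 Definition 6.2 (p. 120)]
[cite: Hartshorne1977, II Ex. 6.8 (a)] -/
theorem detClass_slicePullback_specTwist (P : (A.fibre s).toAbelianVariety.Points L)
    (hW' : IsFiniteLocallyFree ((Scheme.Modules.pullback (A.sliceAt (specTwist σ ≫ s) D lam
      (AlgPoints.map (A.conjFibreIso σ s).hom.hom.hom.hom ((A.fibre s).toAbelianVariety.conjPoints σ P)))).obj D.P))
    (hW : IsFiniteLocallyFree ((Scheme.Modules.pullback (A.sliceAt s D lam P)).obj D.P)) :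
    detClass hW' = CechPic.pullback ψ (detClass hW) :=
  have j : (Scheme.Modules.pullback (A.sliceAt (specTwist σ ≫ s) D lam
        (AlgPoints.map (A.conjFibreIso σ s).hom.hom.hom.hom ((A.fibre s).toAbelianVariety.conjPoints σ P)))).obj D.P ≅
      (Scheme.Modules.pullback ψ).obj ((Scheme.Modules.pullback (A.sliceAt s D lam P)).obj D.P) :=
    (Scheme.Modules.pullbackCongr (A.sliceAt_specTwist_eq_comp_sliceAt D lam σ s ψ hψ P)).app D.P ≪≫
      ((Scheme.Modules.pullbackComp _ _).app D.P).symm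
  (detClass_eq_of_iso j hW' (hW.pullback _)).trans (detClass_pullback _ hW)

variable [IsDominant ψ]

/-- `[ψ^*Θ] = ψ^*[Θ]` in `Ȟ¹(A_{Spec σ ≫ s}, 𝒪^×)`. [cite: GortzWedhorn2020, Prop. 11.21 (p. 374) and Def. 11.49 (p. 392)] -/
theorem cechClass_pullback_psi (Θ : CartierDivisor (A.fibre s).toAbelianVariety.X.left) :
    (Θ.pullback ψ).cechClass = CechPic.pullback ψ Θ.cechClass :=
  CartierDivisor.cechClass_pullback Θ ψ

include hψ in
/-- **`λ̄ = Λ(𝒪(Θ))` at `s` implies `λ̄ = Λ(𝒪(ψ^*Θ))` at the twisted point `Spec σ ≫ s`** — Milne's «`σ(A, s, …) =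
(σA, σs, …)`» for [MumfordFogartyKirwan1994, Def. 6.2–6.3] read through the Poincaré sheaf: at `P′ = e(P^σ)` both
sides are rank-one modules on the integral fibre `A_{Spec σ ≫ s}` with the same class,
`[𝒫|slice′_{λ̄(P′)}] = ψ^*[𝒫|slice_{λ̄(P)}] = ψ^*(t_P^*[Θ]·[Θ]⁻¹) = t_{P′}^*[ψ^*Θ]·[ψ^*Θ]⁻¹` (`t_{P′} ≫ ψ = ψ ≫ t_P`),
hence isomorphic (★ `nonempty_iso_iff_detClass_eq`); every `P′` is an `e(P^σ)`.
[cite: Milne2005ShimuraVarieties, §14 pp. 124–125] [cite: MumfordFogartyKirwan1994, Ch. 6 §2 Definition 6.2–6.3 (p. 120)]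
[cite: Hartshorne1977, III Ex. 4.5] -/
theorem IsLambdaOfAt.along_specTwist {Θ : CartierDivisor (A.fibre s).toAbelianVariety.X.left}
    (h : A.IsLambdaOfAt s D lam Θ) : A.IsLambdaOfAt (specTwist σ ≫ s) D lam (Θ.pullback ψ) := by
  intro P'
  obtain ⟨P, rfl⟩ := A.exists_eq_map_conjFibreIso_conjPoints σ s P'
  obtain ⟨i⟩ := h P
  have hl' : HasRank ((Scheme.Modules.pullback (A.sliceAt (specTwist σ ≫ s) D lam
      (AlgPoints.map (A.conjFibreIso σ s).hom.hom.hom.hom ((A.fibre s).toAbelianVariety.conjPoints σ P)))).obj D.P) 1 :=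
    hasRank_pullback _ D.hasRank_one
  have hl : HasRank ((Scheme.Modules.pullback (A.sliceAt s D lam P)).obj D.P) 1 := hasRank_pullback _ D.hasRank_one
  have hr' : HasRank (tensorObj
      ((Scheme.Modules.pullback (((A.fibre (specTwist σ ≫ s)).toAbelianVariety.translation
        (AlgPoints.map (A.conjFibreIso σ s).hom.hom.hom.hom ((A.fibre s).toAbelianVariety.conjPoints σ P))).left)).obj
        (A.lineBundleOfDivisor (specTwist σ ≫ s) (Θ.pullback ψ)))
      (Modules.dual (A.lineBundleOfDivisor (specTwist σ ≫ s) (Θ.pullback ψ)))) 1 :=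
    hasRank_tensorObj_one (hasRank_pullback _ (A.hasRank_lineBundleOfDivisor _ _))
      (hasRank_dual (A.hasRank_lineBundleOfDivisor _ _))
  have hr : HasRank (tensorObj
      ((Scheme.Modules.pullback ((A.fibre s).toAbelianVariety.translation P).left).obj (A.lineBundleOfDivisor s Θ))
      (Modules.dual (A.lineBundleOfDivisor s Θ))) 1 :=
    hasRank_tensorObj_one (hasRank_pullback _ (A.hasRank_lineBundleOfDivisor _ Θ))
      (hasRank_dual (A.hasRank_lineBundleOfDivisor _ Θ))
  refine (nonempty_iso_iff_detClass_eq hl' hr' (HasRank.isFiniteLocallyFree' hl')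
    (HasRank.isFiniteLocallyFree' hr')).2 ?_
  have hnat := A.translation_left_comp_psi σ s ψ hψ P
  have lhs_eq : detClass (HasRank.isFiniteLocallyFree' hl') =
      CechPic.pullback ψ
        (CechPic.pullback ((A.fibre s).toAbelianVariety.translation P).left Θ.cechClass * (Θ.cechClass)⁻¹) :=
    (A.detClass_slicePullback_specTwist D lam σ s ψ hψ P _ (HasRank.isFiniteLocallyFree' hl)).trans
      (congrArg (CechPic.pullback ψ)
        ((detClass_eq_of_iso i _ (HasRank.isFiniteLocallyFree' hr)).trans
          (A.detClass_translationPullback_tensor_dual s Θ _ _)))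
  have mid : CechPic.pullback ψ
        (CechPic.pullback ((A.fibre s).toAbelianVariety.translation P).left Θ.cechClass * (Θ.cechClass)⁻¹) =
      CechPic.pullback (((A.fibre (specTwist σ ≫ s)).toAbelianVariety.translation
          (AlgPoints.map (A.conjFibreIso σ s).hom.hom.hom.hom ((A.fibre s).toAbelianVariety.conjPoints σ P))).left)
        (CechPic.pullback ψ Θ.cechClass) * (CechPic.pullback ψ Θ.cechClass)⁻¹ := by
    rw [map_mul, map_inv, cechPic_pullback_pullback', cechPic_pullback_pullback', hnat]
  have rhs_eq : detClass (HasRank.isFiniteLocallyFree' hr') =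
      CechPic.pullback (((A.fibre (specTwist σ ≫ s)).toAbelianVariety.translation
          (AlgPoints.map (A.conjFibreIso σ s).hom.hom.hom.hom ((A.fibre s).toAbelianVariety.conjPoints σ P))).left)
        (CechPic.pullback ψ Θ.cechClass) * (CechPic.pullback ψ Θ.cechClass)⁻¹ := by
    rw [A.detClass_translationPullback_tensor_dual (specTwist σ ≫ s) (Θ.pullback ψ) _
      (HasRank.isFiniteLocallyFree' hr'), A.cechClass_pullback_psi σ s ψ Θ]
  exact lhs_eq.trans (mid.trans rhs_eq.symm)

/-! ### §4 The `σ`-reading of the level Weil pairing of `λ̄` -/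

include hψ in
/-- **THE `σ`-READING OF THE PAIRING** (Milne's «`σ(A, s, ηK) = (σA, σs, σηK)`» on `e_N`; Shimura §18.6:
`e^{X^σ}_N(t^σ, s^σ) = e^X_N(t, s)^σ`).  Let `λ̄ = Λ(𝒪(Θ))` at `s` and `λ̄ = Λ(𝒪(Θ′))` at `Spec σ ≫ s` for ANY witnesses
`Θ, Θ′`.  Then for `N`-torsion points `P, Q` of `A_s` and `P′, Q′` of `A_{Spec σ ≫ s}` with `e(P^σ) = P′`, `e(Q^σ) = Q′`:
`ē^{Θ′}_N(P′, Q′) = σ (ē^{Θ}_N(P, Q))`.  Proof: `ē^{Θ′} = ē^{ψ^*Θ}` (§3 + §1), `ψ^*Θ ∼ (e⁻¹)^*(Θ^σ)` so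
`ē^{ψ^*Θ}(P′, Q′) = ē^{Θ^σ}(P^σ, Q^σ)` (★ `weilPairingLevel_pullback_eq`), `= σ ē^{Θ}(P, Q)` (★ `weilPairingLevel_conjugate`).
[cite: Shimura1998, §18.6 proof (p. 130)] [cite: Milne2005ShimuraVarieties, §14 pp. 124–125]
[cite: Lang1983AbelianVarieties, Ch. VII §2 Prop. 3] -/
theorem IsLambdaOfAt.weilPairingLevel_specTwist_eq_conjugate
    {Θ : CartierDivisor (A.fibre s).toAbelianVariety.X.left}
    {Θ' : CartierDivisor (A.fibre (specTwist σ ≫ s)).toAbelianVariety.X.left}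
    (h : A.IsLambdaOfAt s D lam Θ) (h' : A.IsLambdaOfAt (specTwist σ ≫ s) D lam Θ') {N : ℕ}
    [IsDominant (AbelianVariety.Hom.toSchemeHom ((N : ℤ) • 𝟙 (A.fibre s).toAbelianVariety))]
    [IsDominant (AbelianVariety.Hom.toSchemeHom ((N : ℤ) • 𝟙 ((A.fibre s).toAbelianVariety.conjugate σ)))]
    [IsDominant (AbelianVariety.Hom.toSchemeHom ((N : ℤ) • 𝟙 (A.fibre (specTwist σ ≫ s)).toAbelianVariety))]
    (P Q : (A.fibre s).toAbelianVariety.torsionPoints L N)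
    (P' Q' : (A.fibre (specTwist σ ≫ s)).toAbelianVariety.torsionPoints L N)
    (hP : AlgPoints.map (A.conjFibreIso σ s).hom.hom.hom.hom ((A.fibre s).toAbelianVariety.conjPoints σ P.1) = P'.1)
    (hQ : AlgPoints.map (A.conjFibreIso σ s).hom.hom.hom.hom ((A.fibre s).toAbelianVariety.conjPoints σ Q.1) = Q'.1) :
    (A.fibre (specTwist σ ≫ s)).toAbelianVariety.weilPairingLevel Θ' P' Q' =
      σ ((A.fibre s).toAbelianVariety.weilPairingLevel Θ P Q) := by
  haveI hinv : IsDominant (AbelianVariety.Hom.toSchemeHom (A.conjFibreIso σ s).inv) :=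
    AbelianVariety.isDominant_toSchemeHom_iso_hom (A.conjFibreIso σ s).symm
  -- the projection `π_σ` of the conjugate, typed on `(A_s)^σ` (the `π`/`hπ` pattern of ★ `weilPairingLevel_conjugate`)
  obtain ⟨π, hπ⟩ : ∃ π : ((A.fibre s).toAbelianVariety.conjugate σ).X.left ⟶ (A.fibre s).toAbelianVariety.X.left,
      π = baseChangeHomFst σ.toRingHom (A.fibre s).toAbelianVariety.X := ⟨_, rfl⟩
  haveI hπd : IsDominant π := by
    rw [hπ]
    exact AbelianVariety.isDominant_baseChangeHomFst σ (A.fibre s).toAbelianVariety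
  have hψ' : ψ = AbelianVariety.Hom.toSchemeHom (A.conjFibreIso σ s).inv ≫ π := by
    rw [hπ]
    exact hψ
  haveI : IsDominant (AbelianVariety.Hom.toSchemeHom (A.conjFibreIso σ s).inv ≫ π) := by
    rw [← hψ']
    infer_instance
  -- (1) witness-independence at the twisted point: replace `Θ'` by `ψ^*Θ`
  rw [h'.weilPairingLevel_eq A D lam (specTwist σ ≫ s) (h.along_specTwist A D lam σ s ψ hψ) P' Q']
  -- (2) `ψ^*Θ ∼ (e⁻¹)^*(π_σ^*Θ)`
  have hsame : (Θ.pullback ψ).SameDivisor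
      ((Θ.pullback π).pullback (AbelianVariety.Hom.toSchemeHom (A.conjFibreIso σ s).inv)) :=
    (Θ.pullback_congr_sameDivisor hψ').trans (Θ.pullback_pullback_sameDivisor _ _).symm
  rw [AbelianVariety.weilPairingLevel_congr_sameDivisor hsame]
  -- (3) transport along the isomorphism `e⁻¹`, landing at the conjugate points `P^σ, Q^σ`
  have hP' : (((A.fibre s).toAbelianVariety.conjPoints σ P.1 : ((A.fibre s).toAbelianVariety.conjugate σ).Points L)) =
      AlgPoints.map (A.conjFibreIso σ s).inv.hom.hom.hom P'.1 := by
    rw [← hP, map_conjFibreIso_inv_map_hom]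
  have hQ' : (((A.fibre s).toAbelianVariety.conjPoints σ Q.1 : ((A.fibre s).toAbelianVariety.conjugate σ).Points L)) =
      AlgPoints.map (A.conjFibreIso σ s).inv.hom.hom.hom Q'.1 := by
    rw [← hQ, map_conjFibreIso_inv_map_hom]
  rw [AbelianVariety.weilPairingLevel_pullback_eq (A.conjFibreIso σ s).inv (Θ.pullback π) P' Q'
    ⟨(A.fibre s).toAbelianVariety.conjPoints σ P.1, AbelianVariety.conjPoints_mem_torsionPoints σ _ P.2⟩
    ⟨(A.fibre s).toAbelianVariety.conjPoints σ Q.1, AbelianVariety.conjPoints_mem_torsionPoints σ _ Q.2⟩ hP' hQ']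
  -- (4) the conjugate pairing
  exact AbelianVariety.weilPairingLevel_conjugate σ (A.fibre s).toAbelianVariety π hπ Θ P Q

end Psi

end AbelianSchemeOver

end Literature.AlgebraicGeometry.AbelianSchemes

end
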